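import Summits.Ventures.HSemireg.WedgeDegeneratePair
import Summits.Ventures.HSemireg.WedgeBasisFree

/-!
# Venture HSemireg — THEOREM T′ (degenerate pairs / sub-torus ideals) COORDINATE-FREE: `(1+t)^b · P_{n−b}(t)` in any basis

HONEST FRAMING. Part of the Lean index of the computation cell `pub-hsemireg` (seat p10 gen 6, Sunday typer «UNIFORM-IN-n»).
Finite-dimensional EXTERIOR ALGEBRA over a field ONLY: no variety, no cohomology theory, no sheaf, no Ext group and no
semiregularity map is constructed here; nothing here says that HC / HC_CM / HC_AV holds; no Literature fact is declared or used.
Custodian versions cited: theory/FORMULA-N.md PART A §2.5 (th-6, THEOREM T′), as in `WedgeDegeneratePair.lean`.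

The leaf that joins `WedgeDegeneratePair.lean` (THEOREM T′ in the coordinate model: the class `degPair a c′ T = (a·E_{X′} + c′·E_{Y′}) ∧ E_T`
on `⋀ K^{(c+c)+d}` has wedge ranks `tPrimeRank c (d − |T|) k = [t^k] P_c(t)·(1+t)^{d−|T|}`) with `WedgeBasisFree.lean` (wedge ranks are
invariant under linear equivalences; `mapEquiv β.equivFun` sends the monomials of ANY basis `β` of ANY `V` to the model monomials):
* `degPair_eq`: the model class, unfolded into model monomials: `degPair a c′ T = (a·B_{X′} + c′·B_{Y′}) · B_{torus T}`
  (`X′`, `Y′` = th-7's `Xset c`, `Yset c` pushed into `Fin ((c+c)+d)` along `Fin.castAddOrderEmb d`);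
* **`theoremTprime_basis`**: for ANY `K`-space `V` with ANY basis `β` indexed by `Fin ((c+c)+d)` — read `β = (u, v, w)`: `u, v` the
  two transverse `c`-frames (th-6's `K₁′`, `K₂′`), `w` the `d`-frame of the torus block — and ANY set `T` of torus directions, the class
  `f = (a·(u₀∧⋯∧u_{c−1}) + c′·(v₀∧⋯∧v_{c−1})) ∧ w_T` (`w_T` = the increasing product of the `w_i`, `i ∈ T`; `a, c′ ≠ 0`, `c ≥ 1`) has
  **`rank(θ ↦ θ ∧ f ∣ ⋀^k V) = tPrimeRank c (d − |T|) k = Σ_{i ≤ k} r_i(c)·C(d − |T|, k − i)`** for every `k`, i.e. (`…_eq_coeff`)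
  `= [t^k] (1+t)^{d−|T|}·P_c(t)` with th-6's `P`; with `d = b + b`, `|T| = b`: **`theoremTprime_basisFree`: `= [t^k] (1+t)^b·P_c(t)`** —
  THEOREM T′ for the sub-torus-ideal-type class `c₁vol(K₁) + c₂vol(K₂)`, `K_j = ⟨w_T⟩ ⊕ ⟨u⟩` resp. `⟨w_T⟩ ⊕ ⟨v⟩`, `dim K₁ ∩ K₂ = b`, in an
  ARBITRARY basis of an ARBITRARY `V` (th-6's adapted-basis step discharged by `WedgeBasisFree.finrank_range_wedgeV_eq_model`).
NOT here: the Ext side (THEOREM E′), as always by value only.  Namespace `Summit.Ventures.HSemireg.Wedge.DegeneratePair`; new names only.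
-/

open Module Set Set.powersetCard Polynomial

namespace Summit.Ventures.HSemireg.Wedge.DegeneratePair

open Summit.Ventures.HSemireg.Wedge Summit.Ventures.HSemireg.Wedge.Kunneth Summit.Ventures.HSemireg.Wedge.BasisFree

variable (K : Type*) [Field K] {V : Type*} [AddCommGroup V] [Module K V]

variable {c d : ℕ}

/-- the model class unfolded into model monomials: `degPair a c′ T = (a·B_{X′} + c′·B_{Y′}) · B_{torus T}`. -/
theorem degPair_eq (a c' : K) (T : Finset (Fin d)) :
    degPair K (c := c) a c' T =
      (a • B K (Fin ((c + c) + d)) ((WedgePair.Xset c).map (Fin.castAddOrderEmb d).toEmbedding) +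
        c' • B K (Fin ((c + c) + d)) ((WedgePair.Yset c).map (Fin.castAddOrderEmb d).toEmbedding)) *
        B K (Fin ((c + c) + d)) (torus T) := by
  rw [degPair, PairPowers.pp, WedgePair.pointPair, map_add, map_smul, map_smul, WedgePair.coe_Xpc, WedgePair.coe_Ypc,
    PairPowers.B_pair_eq, PairPowers.B_pair_eq, emb_B, emb_B]

/-- **THEOREM T′ IN AN ARBITRARY BASIS**: `V` any `K`-space, `β` ANY basis of `V` indexed by `Fin ((c+c)+d)` (`β = (u, v, w)`: two
transverse `c`-frames and a torus `d`-frame), `T` any set of torus directions, `a, c′ ≠ 0`, `c ≥ 1`: the class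
`f = (a·β_{X′} + c′·β_{Y′}) ∧ β_{torus T}` has `rank(θ ↦ θ ∧ f ∣ ⋀^k V) = tPrimeRank c (d − |T|) k` for every `k`. -/
theorem theoremTprime_basis (hc : 1 ≤ c) (β : Basis (Fin ((c + c) + d)) K V) {a c' : K} (ha : a ≠ 0) (hc' : c' ≠ 0)
    (T : Finset (Fin d)) (k : ℕ) :
    finrank K (LinearMap.range (wedgeV K k
      ((a • β.ExteriorAlgebra ((WedgePair.Xset c).map (Fin.castAddOrderEmb d).toEmbedding) +
        c' • β.ExteriorAlgebra ((WedgePair.Yset c).map (Fin.castAddOrderEmb d).toEmbedding)) *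
        β.ExteriorAlgebra (torus (c := c) T)))) =
      tPrimeRank c (d - T.card) k := by
  rw [finrank_range_wedgeV_eq_model K β, map_mul, map_add, map_smul, map_smul, mapEquiv_equivFun_basis, mapEquiv_equivFun_basis,
    mapEquiv_equivFun_basis, ← degPair_eq]
  exact finrank_range_wedge_degPair K hc ha hc' T k

/-- the same in `ℤ[X]` with th-6's `P_c`: `rank = [t^k] (1+t)^{d−|T|} · P_c(t)`. -/
theorem theoremTprime_basis_eq_coeff (hc : 1 ≤ c) (β : Basis (Fin ((c + c) + d)) K V) {a c' : K} (ha : a ≠ 0) (hc' : c' ≠ 0)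
    (T : Finset (Fin d)) (k : ℕ) :
    (finrank K (LinearMap.range (wedgeV K k
      ((a • β.ExteriorAlgebra ((WedgePair.Xset c).map (Fin.castAddOrderEmb d).toEmbedding) +
        c' • β.ExteriorAlgebra ((WedgePair.Yset c).map (Fin.castAddOrderEmb d).toEmbedding)) *
        β.ExteriorAlgebra (torus (c := c) T)))) : ℤ) =
      ((1 + X) ^ (d - T.card) * FormulaN.Uniform.P c).coeff k := by
  rw [finrank_range_wedgeV_eq_model K β, map_mul, map_add, map_smul, map_smul, mapEquiv_equivFun_basis, mapEquiv_equivFun_basis,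
    mapEquiv_equivFun_basis, ← degPair_eq]
  exact finrank_range_wedge_degPair_eq_coeff K hc ha hc' T k

/-- **THEOREM T′ (FORMULA-N PART A §2.5) COORDINATE-FREE**: `V` any `K`-space with ANY basis `β = (u, v, w)` indexed by
`Fin ((c+c)+(b+b))`, `T` any `b` of the `2b` torus directions (`⟨w_T⟩ = K₁ ∩ K₂`, the other `b` = the inert `C`), `a, c′ ≠ 0`, `c ≥ 1`,
`n = c + b`: the degenerate pair `f = (a·u₀∧⋯∧u_{c−1} + c′·v₀∧⋯∧v_{c−1}) ∧ w_T = a·vol(K₁) ± c′·vol(K₂)` has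
**`rank(θ ↦ θ ∧ f ∣ ⋀^k V) = [t^k] (1+t)^b · P_c(t)`** for every `k`. -/
theorem theoremTprime_basisFree {b : ℕ} (hc : 1 ≤ c) (β : Basis (Fin ((c + c) + (b + b))) K V) {a c' : K} (ha : a ≠ 0)
    (hc' : c' ≠ 0) (T : Finset (Fin (b + b))) (hT : T.card = b) (k : ℕ) :
    (finrank K (LinearMap.range (wedgeV K k
      ((a • β.ExteriorAlgebra ((WedgePair.Xset c).map (Fin.castAddOrderEmb (b + b)).toEmbedding) +
        c' • β.ExteriorAlgebra ((WedgePair.Yset c).map (Fin.castAddOrderEmb (b + b)).toEmbedding)) *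
        β.ExteriorAlgebra (torus (c := c) T)))) : ℤ) =
      ((1 + X) ^ b * FormulaN.Uniform.P c).coeff k := by
  rw [theoremTprime_basis_eq_coeff K hc β ha hc' T k, hT, Nat.add_sub_cancel]

end Summit.Ventures.HSemireg.Wedge.DegeneratePair
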